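import Summits.PneNP.PneNP.Theses.HeisenbergSparsestCut
import Literature.Computability.Complexity.MaxCutNP
import Literature.Computability.Complexity.CodeFPListKit
import Literature.Computability.Complexity.CodeFPModArith
import Literature.Computability.Complexity.CanonicalCodes
import Literature.Probability.RandomGraphs.PlantedCliqueProgramFP
import Literature.Computability.Complexity.HiraharaMachineParams

/-!
# Route HeisenbergSparsestCut — the typed cut verifier (helper for `SparsestCutDecisionInNP`, stmt-PneNP-2290)

The polynomial-time part of the NP verifier for the YES-language of the sparsest-cut gap problem: on the data
`((n, entries), (a, b))` of an instance (the row-major `n × n` weight list) and a bit string `y` (characteristic vector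
of `S ⊆ Fin n`), compute the two cut sums `cap = Σ_{i∈S, j∉S} w↓(i,j)`, `dem = Σ_{i∈S, j∉S} w↑(i,j)` of the symmetrised
lower / upper triangles by one pass over the `n²` index pairs (`CodeFP.rawProduct`, `CodeFP.map`, a summing fold) and
test `0 < dem ∧ cap · b ≤ a · dem` (`heisenbergSparsestCut_codeFP_cutTest`); and its VALUE on genuine instance data
(`heisenbergSparsestCut_cutSumL_eq_cutWeight`: the list sums are the route's `cutWeight`s of the set read off `y`).
-/

set_option linter.dupNamespace false -- `Summit.PneNP.PneNP.…`: summit = sub-problem name (D-0017 single-conjunct layout)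

namespace Summit.PneNP.PneNP.Theorems

open _root_.Computability Polynomial Finset
open Literature.Computability.Complexity Literature.Computability.Complexity.CodeFP
  Literature.Computability.Complexity.Brick
open Literature.Probability.RandomGraphs.PlantedClique (AKSProg.getD_codeFP)

/-- One term of a cut sum: `[y_i ∧ ¬ y_j] · (if i < j then E[j n + i] else E[i n + j])` (symmetrised LOWER triangle) or the
same with the two index orders swapped (UPPER); context `((E, y), n)`, argument `(i, j)`; polynomial time. [folklore] -/
theorem heisenbergSparsestCut_codeFP_term (upper : Bool) :
    CodeFP (pairE (pairE (pairE (rawE natE) strE) natE) (pairE natE natE)) natE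
      fun q : ((List ℕ × List Bool) × ℕ) × (ℕ × ℕ) =>
        if q.1.1.2.getD q.2.1 false && !q.1.1.2.getD q.2.2 false then
          (if (decide (q.2.1 < q.2.2) == upper) then q.1.1.1.getD (q.2.1 * q.1.2 + q.2.2) 0
            else q.1.1.1.getD (q.2.2 * q.1.2 + q.2.1) 0)
        else 0 := by
  have hE : CodeFP (pairE (pairE (pairE (rawE natE) strE) natE) (pairE natE natE)) (rawE natE)
      fun q : ((List ℕ × List Bool) × ℕ) × (ℕ × ℕ) => q.1.1.1 := (CodeFP.fst _ _).fst'.fst'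
  have hy : CodeFP (pairE (pairE (pairE (rawE natE) strE) natE) (pairE natE natE)) strE
      fun q : ((List ℕ × List Bool) × ℕ) × (ℕ × ℕ) => q.1.1.2 := (CodeFP.fst _ _).fst'.snd'
  have hn : CodeFP (pairE (pairE (pairE (rawE natE) strE) natE) (pairE natE natE)) natE
      fun q : ((List ℕ × List Bool) × ℕ) × (ℕ × ℕ) => q.1.2 := (CodeFP.fst _ _).snd'
  have hi : CodeFP (pairE (pairE (pairE (rawE natE) strE) natE) (pairE natE natE)) natE
      fun q : ((List ℕ × List Bool) × ℕ) × (ℕ × ℕ) => q.2.1 := (CodeFP.snd _ _).fst'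
  have hj : CodeFP (pairE (pairE (pairE (rawE natE) strE) natE) (pairE natE natE)) natE
      fun q : ((List ℕ × List Bool) × ℕ) × (ℕ × ℕ) => q.2.2 := (CodeFP.snd _ _).snd'
  have hget : CodeFP (pairE (rawE natE) natE) natE fun p : List ℕ × ℕ => p.1.getD p.2 0 := rawGetD natE rfl
  have hij := (hget.comp (hE.pair (natAdd.comp ((natMul.comp (hi.pair hn)).pair hj))) :)
  have hji := (hget.comp (hE.pair (natAdd.comp ((natMul.comp (hj.pair hn)).pair hi))) :)
  have hcond : CodeFP (pairE (pairE (pairE (rawE natE) strE) natE) (pairE natE natE)) bitE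
      fun q : ((List ℕ × List Bool) × ℕ) × (ℕ × ℕ) => q.1.1.2.getD q.2.1 false && !q.1.1.2.getD q.2.2 false :=
    (AKSProg.getD_codeFP.comp (hy.pair hi) :).and (AKSProg.getD_codeFP.comp (hy.pair hj) :).not
  have hlt : CodeFP (pairE (pairE (pairE (rawE natE) strE) natE) (pairE natE natE)) bitE
      fun q : ((List ℕ × List Bool) × ℕ) × (ℕ × ℕ) => (decide (q.2.1 < q.2.2) == upper) :=
    ((CodeFP.beq bitE_injective).comp ((natLt.comp (hi.pair hj)).pair (CodeFP.const _ upper)) :)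
  exact hcond.ite (hlt.ite hij hji) (CodeFP.const _ 0)

/-- **The cut sum** over all index pairs `(i, j) ∈ [0, min n B) × [0, min n B)` (`B` a unary budget), as a function of
`(((E, y), n), B)`; polynomial time. [cite: AroraBarak2009, §1.3] [folklore] -/
theorem heisenbergSparsestCut_codeFP_cutSum (upper : Bool) :
    CodeFP (pairE (pairE (pairE (rawE natE) strE) natE) unE) natE
      fun r : ((List ℕ × List Bool) × ℕ) × ℕ =>
        (((List.range (min r.1.2 r.2)).product (List.range (min r.1.2 r.2))).map fun ij : ℕ × ℕ =>
          if r.1.1.2.getD ij.1 false && !r.1.1.2.getD ij.2 false then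
            (if (decide (ij.1 < ij.2) == upper) then r.1.1.1.getD (ij.1 * r.1.2 + ij.2) 0
              else r.1.1.1.getD (ij.2 * r.1.2 + ij.1) 0)
          else 0).sum := by
  have hrange : CodeFP (pairE (pairE (pairE (rawE natE) strE) natE) unE) (rawE natE)
      fun r : ((List ℕ × List Bool) × ℕ) × ℕ => List.range (min r.1.2 r.2) :=
    (rangeOf.comp ((CodeFP.snd _ _).pair (CodeFP.fst _ _).snd') :)
  have hpairs : CodeFP (pairE (pairE (pairE (rawE natE) strE) natE) unE) (rawE (pairE natE natE))
      fun r : ((List ℕ × List Bool) × ℕ) × ℕ => (List.range (min r.1.2 r.2)).product (List.range (min r.1.2 r.2)) :=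
    ((rawProduct natE natE).comp (hrange.pair hrange) :)
  have hmap := CodeFP.map (heisenbergSparsestCut_codeFP_term upper)
  exact ((Literature.Computability.Complexity.HiraharaMachine.natSum.comp (hmap.comp ((CodeFP.fst _ _).pair hpairs))) :)

/-- **The typed cut test** on `((((E, y), n), B), (a, b))`: `0 < dem ∧ cap · b ≤ a · dem`. [cite: Karp1972, §3 (problem 21 conventions)] [folklore] -/
theorem heisenbergSparsestCut_codeFP_cutTest :
    CodeFP (pairE (pairE (pairE (pairE (rawE natE) strE) natE) unE) (pairE natE natE)) bitE
      fun s : (((List ℕ × List Bool) × ℕ) × ℕ) × (ℕ × ℕ) =>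
        decide (0 < (((List.range (min s.1.1.2 s.1.2)).product (List.range (min s.1.1.2 s.1.2))).map fun ij : ℕ × ℕ =>
          if s.1.1.1.2.getD ij.1 false && !s.1.1.1.2.getD ij.2 false then
            (if (decide (ij.1 < ij.2) == true) then s.1.1.1.1.getD (ij.1 * s.1.1.2 + ij.2) 0
              else s.1.1.1.1.getD (ij.2 * s.1.1.2 + ij.1) 0)
          else 0).sum) &&
        decide ((((List.range (min s.1.1.2 s.1.2)).product (List.range (min s.1.1.2 s.1.2))).map fun ij : ℕ × ℕ =>
          if s.1.1.1.2.getD ij.1 false && !s.1.1.1.2.getD ij.2 false then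
            (if (decide (ij.1 < ij.2) == false) then s.1.1.1.1.getD (ij.1 * s.1.1.2 + ij.2) 0
              else s.1.1.1.1.getD (ij.2 * s.1.1.2 + ij.1) 0)
          else 0).sum * s.2.2 ≤ s.2.1 *
          (((List.range (min s.1.1.2 s.1.2)).product (List.range (min s.1.1.2 s.1.2))).map fun ij : ℕ × ℕ =>
            if s.1.1.1.2.getD ij.1 false && !s.1.1.1.2.getD ij.2 false then
              (if (decide (ij.1 < ij.2) == true) then s.1.1.1.1.getD (ij.1 * s.1.1.2 + ij.2) 0
                else s.1.1.1.1.getD (ij.2 * s.1.1.2 + ij.1) 0)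
            else 0).sum) := by
  have hdem := ((heisenbergSparsestCut_codeFP_cutSum true).comp (CodeFP.fst _ _) :
    CodeFP (pairE (pairE (pairE (pairE (rawE natE) strE) natE) unE) (pairE natE natE)) natE fun s => _)
  have hcap := ((heisenbergSparsestCut_codeFP_cutSum false).comp (CodeFP.fst _ _) :
    CodeFP (pairE (pairE (pairE (pairE (rawE natE) strE) natE) unE) (pairE natE natE)) natE fun s => _)
  have ha : CodeFP (pairE (pairE (pairE (pairE (rawE natE) strE) natE) unE) (pairE natE natE)) natE
      fun s : (((List ℕ × List Bool) × ℕ) × ℕ) × (ℕ × ℕ) => s.2.1 := (CodeFP.snd _ _).fst'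
  have hb : CodeFP (pairE (pairE (pairE (pairE (rawE natE) strE) natE) unE) (pairE natE natE)) natE
      fun s : (((List ℕ × List Bool) × ℕ) × ℕ) × (ℕ × ℕ) => s.2.2 := (CodeFP.snd _ _).snd'
  exact (natLt.comp ((CodeFP.const _ 0).pair hdem) :).and (natLe.comp ((natMul.comp (hcap.pair hb)).pair (natMul.comp (ha.pair hdem))) :)

/-- **Value of a cut sum on genuine data**: for `E = entriesL n w` and any bit string `y`, the list sum over `[0,n)²` is the
route's `cutWeight` of the symmetrised triangle for the set `S = {i | y[i] = 1}`. [cite: Karp1972, §3 (problem 21)] [folklore] -/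
theorem heisenbergSparsestCut_cutSumL_eq_cutWeight (upper : Bool) (n : ℕ) (w : Fin n → Fin n → ℕ) (y : List Bool) :
    (((List.range n).product (List.range n)).map fun ij : ℕ × ℕ =>
        if y.getD ij.1 false && !y.getD ij.2 false then
          (if (decide (ij.1 < ij.2) == upper) then (MaxCutNP.entriesL n w).getD (ij.1 * n + ij.2) 0
            else (MaxCutNP.entriesL n w).getD (ij.2 * n + ij.1) 0)
        else 0).sum =
      cutWeight (fun i j : Fin n => if (decide (i < j) == upper) then w i j else w j i)
        (univ.filter fun i : Fin n => y.getD i false = true) := by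
  classical
  set S : Finset (Fin n) := univ.filter fun i : Fin n => y.getD i false = true with hS
  set f : ℕ × ℕ → ℕ := fun ij => if y.getD ij.1 false && !y.getD ij.2 false then
      (if (decide (ij.1 < ij.2) == upper) then (MaxCutNP.entriesL n w).getD (ij.1 * n + ij.2) 0
        else (MaxCutNP.entriesL n w).getD (ij.2 * n + ij.1) 0) else 0 with hf
  -- list sum = finset sum over `range n ×ˢ range n`
  have hnd : ((List.range n).product (List.range n)).Nodup := List.nodup_range.product List.nodup_range
  have h1 : (((List.range n).product (List.range n)).map f).sum = ∑ ij ∈ ((List.range n).product (List.range n)).toFinset, f ij :=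
    (List.sum_toFinset f hnd).symm
  have h2 : ((List.range n).product (List.range n)).toFinset = (Finset.range n) ×ˢ (Finset.range n) := by
    ext ⟨i, j⟩; simp
  -- the value of `f` on in-range indices
  have hfij : ∀ i j : Fin n, f ((i : ℕ), (j : ℕ)) =
      if y.getD i false && !y.getD j false then (if (decide (i < j) == upper) then w i j else w j i) else 0 := by
    intro i j
    simp only [hf]
    rw [MaxCutNP.getD_entriesL_flat w i j, MaxCutNP.getD_entriesL_flat w j i]
    rfl
  rw [h1, h2, Finset.sum_product, cutWeight]
  rw [← Fin.sum_univ_eq_sum_range (fun i => ∑ j ∈ Finset.range n, f (i, j)) n]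
  have hc : Sᶜ = univ.filter fun j : Fin n => ¬ y.getD j false = true := by
    ext j; simp [hS]
  rw [hc, hS, Finset.sum_filter]
  refine Finset.sum_congr rfl fun i _ => ?_
  rw [← Fin.sum_univ_eq_sum_range (fun j => f (i, j)) n, Finset.sum_filter]
  by_cases hi : y.getD i false = true
  · rw [if_pos hi]
    refine Finset.sum_congr rfl fun j _ => ?_
    rw [hfij]
    by_cases hj : y.getD j false = true
    · rw [if_neg (not_not.2 hj), hi, hj]; rfl
    · have hj' : y.getD (j : ℕ) false = false := by simpa using hj
      rw [if_pos hj, hi, hj']; rfl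
  · rw [if_neg hi]
    refine Finset.sum_eq_zero fun j _ => ?_
    have hi' : y.getD (i : ℕ) false = false := by simpa using hi
    rw [hfij, hi']
    rfl

end Summit.PneNP.PneNP.Theorems
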